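import Mathlib.Analysis.SpecialFunctions.Pow.Real
import Mathlib.Combinatorics.Additive.Energy
import Mathlib.Data.Nat.Squarefree
import Mathlib.Algebra.Group.Int.Even
import Mathlib.Algebra.BigOperators.Fin
import Mathlib.Data.Fin.VecNotation
import Mathlib.Data.Fintype.Pi
import HarnessLib

/-!
# Shute (2021): sums of four squareful numbers — the fourth-moment bound for the shapes `x² y³`

Named facts (D-0014) requested by route `ABC/ExceptionalSetEnergy` (`wi-10446`; supports items
`stmt-ABC-2713` `PowerfulAlmostSidon`, `stmt-ABC-2711` `SquarefulShapeEnergy`, `stmt-ABC-2710`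
`PowerfulHitsSquareRoot`).

Source: A. Shute, *Sums of four squareful numbers*, arXiv:2104.06966 (2021). Every nonzero
squareful integer `z` is uniquely `z = y³ x²` with `x ≥ 1` and `y` a nonzero square-free integer
(§1). Writing `N(𝐗, 𝐘)` for the number of `(𝐱, 𝐲) ∈ (ℤ_{≠0})⁴ × (ℤ_{≠0})⁴` with
`y₁, …, y₄` square-free, `|xᵢ| ≤ Xᵢ`, `|yᵢ| ≤ Yᵢ` and `x₁²y₁³ + x₂²y₂³ + x₃²y₃³ + x₄²y₄³ = 0`
(§3), the paper states (see **Status** below: the printed proof of Prop. 3.2, on which Prop. 3.1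
and Thm. 1.1 rest, is incomplete, and the three statements are recorded as CLAIMS)

* **Proposition 3.2**: `N(𝐗, 𝐘) = O_ε((X₁X₂X₃X₄)^{1/2+ε} (Y₁Y₂Y₃Y₄)^{2/3+ε})`
  (`Literature.NumberTheory.DiophantineGeometry.Shute2021_prop32`, a named fact); its proof
  (§3, Hölder + two Cauchy–Schwarz steps + divisor bounds) passes through the fourth moment
  `N(X, Y) = #{x₁²y₁³ + x₂²y₂³ = x₃²y₃³ + x₄²y₄³ : |xᵢ| ≤ X, |yᵢ| ≤ Y, yᵢ square-free}`
  `= O(X^{2+ε} Y^{8/3+ε})`, which we DERIVE here from Prop. 3.2 (the substitution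
  `(y₃, y₄) ↦ (−y₃, −y₄)` identifies the two counts:
  `Literature.NumberTheory.DiophantineGeometry.Shute2021.fourthMoment_eq_quadricCount`,
  `Literature.NumberTheory.DiophantineGeometry.Shute2021_prop32.fourthMoment_le`), together
  with the additive-energy form the route consumes
  (`Literature.NumberTheory.DiophantineGeometry.Shute2021_prop32.addEnergy_squarefulShape_le`:
  `E[S, S] ≤ C (XY)^ε X² Y^{8/3}` for `S = {x²y³ : 1 ≤ x ≤ X, 1 ≤ y ≤ Y square-free}`, the
  set `S` spelled exactly as in the route item `SquarefulShapeEnergy`);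
* **Proposition 3.1**: `M(B, D) = O_ε(B^{1+ε} D^{-1/12})` for the number `M(B, D)` of primitive
  squareful solutions of `z₁ + z₂ + z₃ + z₄ = 0`, `|zᵢ| ≤ B`, whose square-free parts satisfy
  `|y₁y₂y₃y₄| ≥ D` (`Literature.NumberTheory.DiophantineGeometry.Shute2021_prop31`);
* **Theorem 1.1**: `N(B) = cB + O_ε(B^{734/735+ε})` for the number `N(B)` of primitive vectors of
  nonzero squareful integers `|zᵢ| ≤ B` with `z₁ + ⋯ + z₄ = 0` and `z₁z₂z₃z₄ ≠ □`, with an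
  explicit absolute constant `c > 0`
  (`Literature.NumberTheory.DiophantineGeometry.Shute2021_theorem11`, stated with `∃ c > 0`);
  of its proof we formalize the unique decomposition `z = y³x²` of nonzero squareful integers
  (`IsSquareful.exists_eq_pow_three_mul_sq`, `pow_three_mul_sq_eq_iff`, `squarefulParams`) and
  the first reduction of §5, eq. (5.1) `N(B) = N(D, B) + O_ε(B^{1+ε}D^{-1/12})`
  (`Shute2021.mainCountTrunc` = `N(D, B)`, `Shute2021.mainCount_le_mainCountTrunc_add`:
  `N(B) ≤ N(D, B) + M(B, D+1)`, and `Shute2021_prop31.mainCount_le` from Prop. 3.1).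

## Design

* Vectors with four components are `Fin 4 → ℤ`; the boxes `|vᵢ| ≤ Xᵢ` are the `Finset`s
  `Shute2021.box X = Fintype.piFinset (fun i ↦ Icc (-Xᵢ) Xᵢ)`, so every count is the cardinality
  of a `Finset.filter` (a natural number, no junk value, decidable predicates for the two counts
  provers manipulate: square-freeness of `y : ℤ` is `Squarefree y.natAbs`, cf.
  `Int.squarefree_natAbs`).
* Box sizes are natural numbers `Xᵢ, Yᵢ, B, D ≥ 1`; the paper allows real parameters, but every
  count only depends on the integer parts and the bounds are monotone in the parameters, so the
  integer-parameter statements are equivalent to the printed ones.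
* Implied constants depend on `ε` only ("All implied constants will be allowed to depend on `ε`,
  but nothing else", §1, Notation); we record them as `∃ C > 0` after `∀ ε > 0`.
* `M(B, D)` is defined in the paper on the `z`-side with `(xᵢ, yᵢ)` the decomposition
  `zᵢ = yᵢ³xᵢ²`; we count the parameters `(𝐱, 𝐲)` directly (`xᵢ ≥ 1`, `yᵢ ≠ 0` square-free),
  which is the same set by uniqueness of the decomposition; `zᵢ ≠ 0` and "`zᵢ` squareful" are then
  automatic and `|xᵢ|, |yᵢ| ≤ |zᵢ| ≤ B` bounds the parameter box.

## Deliberately not here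

* Theorem 1.3 / 4.2 (the circle-method asymptotic for `N_𝐚(B)` with the singular series `𝔊_𝐚`
  and singular integral `σ_∞`) — not requested in usable form and heavy to state faithfully.
* The consequence `E[Powerful ∩ [1, N]] ≪ N^{1+ε}` is NOT in the paper; it is the route's support
  item `PowerfulAlmostSidon` (dyadic decomposition in `y` + subadditivity of `E^{1/4}`), to be
  proved problem-side. It does not need the exponent `8/3`: the UNCONDITIONAL
  `Shute2021.addEnergy_le_three_of_subset` (file `ShuteFourSquarefulMoment.lean`, exponent `3`)
  gives `E[S_R] ≤ C_ε N^ε (N/R³)(2R)³ = 8 C_ε N^{1+ε}` for each dyadic piece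
  `S_R = {x²y³ ≤ N : R ≤ y < 2R} ⊆ S(⌊√(N/R³)⌋, 2R)`, there are `≤ log₂ N + 1` pieces, and
  `E^{1/4}` is subadditive, so `E ≤ (log₂ N + 1)⁴ · 8 C_ε N^{1+ε}`; the conditional
  `Shute2021_prop32.addEnergy_le_of_subset` (exponent `8/3`) is not required.
* No proof of Prop. 3.2 itself: see **Status** — the printed argument does not prove it, and it
  is recorded as a claim (Prop. 3.1 is derived from it in the sibling file
  `ShuteFourSquarefulProofs.lean`; the Hölder step and what the printed method does yield are
  proved in `ShuteFourSquarefulHolder.lean`, `ShuteFourSquarefulCounting.lean`,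
  `ShuteFourSquarefulMoment.lean`).
* No proof of Theorem 1.1 beyond (5.1): it needs Theorem 4.2 (= 1.3), Heath-Brown's smooth
  `δ`-function form of the circle method with explicit dependence on the coefficients (§4, built
  on [D. R. Heath-Brown, J. reine angew. Math. 481 (1996), 149–206]), the inclusion–exclusion /
  local-density assembly of §5 (Lemmas 5.1–5.4, choice `D = B^{4/245}`), none of which is in
  `Literature` yet — and Prop. 3.1, hence Prop. 3.2 (see **Status**).

## Status of Prop. 3.2, Prop. 3.1 and Thm. 1.1 (review of 2026-08-15; both versions of the source read)

The three statements are transcribed faithfully, but the source does not contain a complete proof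
of Prop. 3.2, and Prop. 3.1 (deduced from Prop. 3.2, §3) and Thm. 1.1 (which uses Prop. 3.1 through
eq. (5.1)) inherit the gap; the paper is an unrefereed preprint (one arXiv version, 14 Apr 2021),
reproduced verbatim as Chapter 6 of the author's thesis (Shute 2022, §6.3, Prop. 6.3.2, thesis
pp. 79–84), and none of the works citing it re-proves the step. The three named facts below
therefore carry the provenance "claim … status: disputed" (D-0012): what is disputed is the PROOF;
nothing known contradicts the statements (heuristically the fourth moment is `≍ X²Y²`).

The gap (arXiv §3, (3.4)–(3.6) and the last display of §3 = thesis (6.3.4)–(6.3.6) and p. 84).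
After Hölder the task is the fourth-moment bound `N(X, Y) = O(X^{2+ε}Y^{8/3+ε})` for
`N(X, Y) = ∫₀¹ |S(α)|⁴ dα`, `S(α) = Σ_{x,y} e(αx²y³)`. The text bounds `|S(α)|²` pointwise by
Cauchy–Schwarz in `x` and in `y`, integrates, and gets `N(X, Y) ≤ 4XY · L(X, Y)` with
`L(X, Y) = #{(x, x₁, x₂, y, y₁, y₂) : x²(y₁³ − y₂³) = y³(x₁² − x₂²)}` (boxes `X`, `Y`; `y, y₁, y₂`
square-free; all coordinates nonzero), then shows "`L(X, Y) ≪ X^{1+ε}Y^{5/3+ε}`" using twice that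
`x₁ ≠ ±x₂` ("the cases `x₁ = ±x₂` have already been dealt with above", "`u ≠ 0` by the assumption
`x₁ ≠ ±x₂`"). But the earlier exclusion of the "trivial cases `xᵢ = ±xⱼ`" concerns the variables
of `N(X, Y)`, whereas `x₁, x₂` in `L` are new variables created by the Cauchy–Schwarz step, and
the inequality `N ≤ 4XY·L` is only available for the full counts (it integrates a pointwise bound
between non-negative quantities, diagonals included). For the full `L` the display is false: every
tuple with `x₁ = ±x₂`, `y₁ = y₂` and `x, y` arbitrary lies in `L`, so
`L(X, Y) ≥ 2 · (2X)² · Y₁² ≥ 8X²Y²` for all `X, Y ≥ 1` (`Y₁ = #{0 < |y| ≤ Y square-free} ≥ Y`),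
and the chain as printed gives nothing better than `N(X, Y) ≤ 4XY·L`, `4XY·L ≥ 32X³Y³`, weaker
than the trivial bound. Every positivity-preserving variant of the step multiplies the diagonal
`≍ X²Y²` of `N(X, Y)` by the length of the Cauchy–Schwarz variable; the best the printed method
gives is the exponent `3` in place of `8/3` (one Cauchy–Schwarz in `y` and the divisor bound),
proved in this library as `Shute2021.fourthMoment_le_three`, whence the shape of Prop. 3.2 with
`3/4` in place of `2/3` (`Shute2021.quadricCount_le_threeQuarters`) and
`E[S, S] ≪_ε (XY)^ε X²Y³` (`Shute2021.addEnergy_squarefulShape_le_three`). With `3/4` the dyadic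
deduction of Prop. 3.1 yields no saving in `D` at all, so neither Prop. 3.1 nor Thm. 1.1 follows
from what is proved. (Harness record: review seat `literature-prover-rsplit-…-84469958a2`, evidence
file `Shute2021_prop32_gap.md`.)

## References

* A. Shute, *Sums of four squareful numbers*, arXiv:2104.06966 [math.NT] (2021), §1: Theorem 1.1,
  (1.1)–(1.3), Notation; §3: Propositions 3.1, 3.2 and the proof of Prop. 3.2; the unique
  decomposition `z = y³x²` of a nonzero squareful integer is recalled in §1 and §3; §5, eq. (5.1)
  (`N(B) = N(D,B) + O(B^{1+ε}D^{-1/12})`, definition of `N(D, B)`). [Shute2021]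
* A. L. Shute, *Existence and density problems in Diophantine geometry: From norm forms to Campana
  points*, PhD thesis, Institute of Science and Technology Austria (2022),
  doi:10.15479/at:ista:12072, Chapter 6 (= the paper), §6.3, Propositions 6.3.1, 6.3.2 and the
  proof of Prop. 6.3.2 (thesis pp. 79–84): checked to be textually identical with arXiv v1 §3 at
  the step discussed under **Status**. [Shute2022thesis]
-/

noncomputable section

open Finset

namespace Literature.NumberTheory.DiophantineGeometry

/-! ### Squareful integers -/

/-- A nonzero integer `z` is **squareful** (`2`-full): for every prime `p`, `p ∣ z ⟹ p² ∣ z`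
("a nonzero integer `z` is `m`-full if for any prime `p ∣ z` we have `p^m ∣ z`, and squareful if
it is `2`-full"). [cite: Shute2021, §1] -/
def IsSquareful (z : ℤ) : Prop :=
  z ≠ 0 ∧ ∀ p : ℕ, p.Prime → (p : ℤ) ∣ z → (p : ℤ) ^ 2 ∣ z

/-- `IsSquareful z` in terms of the prime factors of `|z|` (the form used by route items over `ℕ`:
`∀ p ∈ n.primeFactors, p ^ 2 ∣ n`). [folklore] -/
theorem isSquareful_iff_primeFactors {z : ℤ} :
    IsSquareful z ↔ z ≠ 0 ∧ ∀ p ∈ z.natAbs.primeFactors, p ^ 2 ∣ z.natAbs := by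
  refine and_congr_right fun hz => ⟨fun h p hp => ?_, fun h p hp hdvd => ?_⟩
  · rw [Nat.mem_primeFactors] at hp
    have h2 : ((p ^ 2 : ℕ) : ℤ) ∣ z := by exact_mod_cast h p hp.1 (Int.natCast_dvd.2 hp.2.1)
    exact Int.natCast_dvd.1 h2
  · have hmem : p ∈ z.natAbs.primeFactors :=
      Nat.mem_primeFactors.2 ⟨hp, Int.natCast_dvd.1 hdvd, Int.natAbs_ne_zero.2 hz⟩
    have h2 : ((p ^ 2 : ℕ) : ℤ) ∣ z := Int.natCast_dvd.2 (h p hmem)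
    exact_mod_cast h2

/-- A natural number `n`, viewed in `ℤ`, is squareful iff `n ≠ 0` and `p² ∣ n` for every prime
factor `p` of `n`. [folklore] -/
theorem isSquareful_natCast_iff {n : ℕ} :
    IsSquareful (n : ℤ) ↔ n ≠ 0 ∧ ∀ p ∈ n.primeFactors, p ^ 2 ∣ n := by
  rw [isSquareful_iff_primeFactors, Int.natAbs_natCast]
  exact and_congr_left fun _ => by exact_mod_cast Iff.rfl

namespace Shute2021

/-! ### The counting functions of §3 -/

/-- The box `{𝐯 ∈ ℤ⁴ : |vᵢ| ≤ Xᵢ}` as a `Finset (Fin 4 → ℤ)`. [folklore] -/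
def box (X : Fin 4 → ℕ) : Finset (Fin 4 → ℤ) :=
  Fintype.piFinset fun i => Icc (-(X i : ℤ)) (X i)

/-- Membership in `box X`: `|vᵢ| ≤ Xᵢ` for all `i`. [folklore] -/
theorem mem_box {X : Fin 4 → ℕ} {v : Fin 4 → ℤ} : v ∈ box X ↔ ∀ i, |v i| ≤ X i := by
  simp [box, Fintype.mem_piFinset, abs_le]

/-- Shute's `N(𝐗, 𝐘)` (§3, before Prop. 3.2): the number of `(𝐱, 𝐲) ∈ (ℤ_{≠0})⁴ × (ℤ_{≠0})⁴` with
`y₁, …, y₄` square-free, `|xᵢ| ≤ Xᵢ`, `|yᵢ| ≤ Yᵢ` for all `i`, and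
`x₁²y₁³ + x₂²y₂³ + x₃²y₃³ + x₄²y₄³ = 0`. [cite: Shute2021, §3 (definition of N(X,Y))] -/
def quadricCount (X Y : Fin 4 → ℕ) : ℕ :=
  #{p ∈ box X ×ˢ box Y |
      (∀ i, p.1 i ≠ 0 ∧ p.2 i ≠ 0 ∧ Squarefree (p.2 i).natAbs) ∧ ∑ i, p.1 i ^ 2 * p.2 i ^ 3 = 0}

/-- The fourth moment `N(X, Y) = ∫₀¹ |S_k(α)|⁴ dα` of the proof of Prop. 3.2: the number of
`(𝐱, 𝐲) ∈ (ℤ_{≠0})⁴ × (ℤ_{≠0})⁴` with `y₁, …, y₄` square-free, `|xᵢ| ≤ X`, `|yᵢ| ≤ Y` and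
`x₁²y₁³ + x₂²y₂³ = x₃²y₃³ + x₄²y₄³` (indices `0,1,2,3` of `Fin 4`).
[cite: Shute2021, §3, proof of Prop. 3.2 (definition of N(X,Y))] -/
def fourthMoment (X Y : ℕ) : ℕ :=
  #{p ∈ box (fun _ => X) ×ˢ box (fun _ => Y) |
      (∀ i, p.1 i ≠ 0 ∧ p.2 i ≠ 0 ∧ Squarefree (p.2 i).natAbs) ∧
        p.1 0 ^ 2 * p.2 0 ^ 3 + p.1 1 ^ 2 * p.2 1 ^ 3 =
          p.1 2 ^ 2 * p.2 2 ^ 3 + p.1 3 ^ 2 * p.2 3 ^ 3}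

/-- The squareful shape `S(X, Y) = {x² y³ : 1 ≤ x ≤ X, 1 ≤ y ≤ Y, y square-free} ⊆ ℕ` (the
positive squareful numbers with bounded parameters), spelled exactly as the `S` of route item
`SquarefulShapeEnergy`. [folklore] -/
def squarefulShape (X Y : ℕ) : Finset ℕ :=
  (Finset.Icc 1 X ×ˢ (Finset.Icc 1 Y).filter Squarefree).image (fun p : ℕ × ℕ => p.1 ^ 2 * p.2 ^ 3)

/-- A vector `𝐳 ∈ ℤ⁴` is **primitive** (`𝐳 ∈ ℤ⁴_prim`): `gcd(z₁, …, z₄) = 1`, i.e. no natural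
number `d ≠ 1` divides every coordinate. [cite: Shute2021, §1 (Notation)] -/
def IsPrimitive (z : Fin 4 → ℤ) : Prop :=
  ∀ d : ℕ, (∀ i, (d : ℤ) ∣ z i) → d = 1

open Classical in
/-- Shute's `N(B) = #(𝒩₄(B) ∖ 𝒯)` (eq. (1.1)–(1.3)): the number of primitive `𝐳 ∈ (ℤ_{≠0})⁴` with
every `zᵢ` squareful, `|zᵢ| ≤ B`, `z₁ + z₂ + z₃ + z₄ = 0`, outside the thin set
`𝒯 = {z₁z₂z₃z₄ = □}`. [cite: Shute2021, §1, (1.1)–(1.3)] -/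
def mainCount (B : ℕ) : ℕ :=
  #{z ∈ box (fun _ => B) |
      (∀ i, IsSquareful (z i)) ∧ IsPrimitive z ∧ ∑ i, z i = 0 ∧ ¬ IsSquare (∏ i, z i)}

open Classical in
/-- Shute's `M(B, D)` (§3): the number of primitive `𝐳 ∈ (ℤ_{≠0})⁴` with `z₁ + ⋯ + z₄ = 0`, every
`zᵢ` squareful, `|𝐳| ≤ B` and `|y₁y₂y₃y₄| ≥ D`, where `zᵢ = yᵢ³xᵢ²` with `xᵢ ≥ 1` and `yᵢ`
square-free. Counted here through the parameters `(𝐱, 𝐲)` (the decomposition is unique, so this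
is the same set; `|xᵢ|, |yᵢ| ≤ |zᵢ| ≤ B`). [cite: Shute2021, §3 (definition of M(B,D))] -/
def largeCoeffCount (B D : ℕ) : ℕ :=
  #{p ∈ box (fun _ => B) ×ˢ box (fun _ => B) |
      (∀ i, 0 < p.1 i ∧ p.2 i ≠ 0 ∧ Squarefree (p.2 i).natAbs ∧ |p.2 i ^ 3 * p.1 i ^ 2| ≤ (B : ℤ)) ∧
      IsPrimitive (fun i => p.2 i ^ 3 * p.1 i ^ 2) ∧ ∑ i, p.2 i ^ 3 * p.1 i ^ 2 = 0 ∧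
      (D : ℤ) ≤ |∏ i, p.2 i|}

end Shute2021

/-! ### The named facts -/

/-- **Shute (2021), Proposition 3.2** (as printed; a CLAIM — see Status). For every `ε > 0` there is
`C = C(ε)` such that for all `X₁, …, X₄, Y₁, …, Y₄ ≥ 1`,
`N(𝐗, 𝐘) ≤ C (X₁X₂X₃X₄)^{1/2+ε} (Y₁Y₂Y₃Y₄)^{2/3+ε}`,
where `N(𝐗, 𝐘)` counts `(𝐱, 𝐲) ∈ (ℤ_{≠0})⁴ × (ℤ_{≠0})⁴` with `yᵢ` square-free, `|xᵢ| ≤ Xᵢ`,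
`|yᵢ| ≤ Yᵢ` and `Σ xᵢ² yᵢ³ = 0` (`Shute2021.quadricCount`). Locator: arXiv:2104.06966v1, §3,
Prop. 3.2 (= Shute, PhD thesis ISTA 2022, Prop. 6.3.2, identical text).

Status: the printed proof (arXiv §3, pp. 9–10 = thesis pp. 81–84) is incomplete and no other proof
is published. It reduces (correctly, by Hölder: `Shute2021.quadricCount_pow_four_le`; the statement
is EQUIVALENT to the fourth-moment bound `N(X, Y) ≪_ε X^{2+ε}Y^{8/3+ε}` by
`Shute2021_prop32_iff_fourthMoment_le`) to bounding the fourth moment, and for that asserts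
`N(X, Y) ≤ 4XY·L(X, Y)` (two pointwise Cauchy–Schwarz steps, valid for the full counts only) and
`L(X, Y) ≪ X^{1+ε}Y^{5/3+ε}`; the latter is false for `L` as defined there, since `L` contains the
`≥ 8X²Y²` tuples with `x₁ = ±x₂`, `y₁ = y₂`, `x, y` free — the text's "the cases `x₁ = ±x₂` have
already been dealt with" refers to the variables of `N(X, Y)`, not to those of `L` (module docstring,
section Status). What the printed method does prove (exponent `3` for `8/3`, i.e. `3/4` for `2/3`
here) is `Shute2021.fourthMoment_le_three` / `Shute2021.quadricCount_le_threeQuarters`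
(file `ShuteFourSquarefulMoment.lean`). Users should treat `(h : Shute2021_prop32)` as an open
hypothesis. [claim: Shute2021, status: disputed] -/
def Shute2021_prop32 : Prop :=
  ∀ ε : ℝ, 0 < ε → ∃ C : ℝ, 0 < C ∧ ∀ X Y : Fin 4 → ℕ, (∀ i, 1 ≤ X i) → (∀ i, 1 ≤ Y i) →
    (Shute2021.quadricCount X Y : ℝ) ≤
      C * (∏ i, (X i : ℝ)) ^ (1 / 2 + ε) * (∏ i, (Y i : ℝ)) ^ (2 / 3 + ε)

/-- **Shute (2021), Proposition 3.1.** For every `ε > 0` there is `C = C(ε)` such that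
`M(B, D) ≤ C B^{1+ε} D^{-1/12}` for all `B, D ≥ 1` (`Shute2021.largeCoeffCount`: primitive
squareful solutions of `z₁ + z₂ + z₃ + z₄ = 0` with `|zᵢ| ≤ B` whose square-free parts have
`|y₁y₂y₃y₄| ≥ D`). Locator: arXiv:2104.06966v1, §3, Prop. 3.1 (= thesis Prop. 6.3.1).
Status: deduced in the source from Prop. 3.2 by a dyadic decomposition (formalized:
`Shute2021_prop32.prop31`, file `ShuteFourSquarefulProofs.lean`); it inherits the gap in the
printed proof of Prop. 3.2 (see `Shute2021_prop32` and the module docstring, section Status), and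
the proved exponent `3/4` gives no saving in `D`. No independent proof is published.
[claim: Shute2021, status: disputed] -/
def Shute2021_prop31 : Prop :=
  ∀ ε : ℝ, 0 < ε → ∃ C : ℝ, 0 < C ∧ ∀ B D : ℕ, 1 ≤ B → 1 ≤ D →
    (Shute2021.largeCoeffCount B D : ℝ) ≤ C * (B : ℝ) ^ (1 + ε) * (D : ℝ) ^ (-(1 / 12 : ℝ))

/-- **Shute (2021), Theorem 1.1.** There is an absolute constant `c > 0` (given explicitly in the
paper, §5) such that for every `ε > 0`, `N(B) = cB + O_ε(B^{734/735+ε})`, where `N(B)` counts the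
primitive vectors of nonzero squareful integers `|zᵢ| ≤ B` with `z₁ + z₂ + z₃ + z₄ = 0` and
`z₁z₂z₃z₄` not a square (`Shute2021.mainCount`). We only assert the existence of `c`.
Locator: arXiv:2104.06966v1, Thm. 1.1 (= thesis Thm. 6.1.1). Status: the printed proof uses
Prop. 3.1 through eq. (5.1) and hence Prop. 3.2, whose printed proof is incomplete (see
`Shute2021_prop32` and the module docstring, section Status); the remaining ingredients (Thm. 4.2,
§5) are not in question here but are not formalized either. No independent proof is published.
[claim: Shute2021, status: disputed] -/
def Shute2021_theorem11 : Prop :=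
  ∃ c : ℝ, 0 < c ∧ ∀ ε : ℝ, 0 < ε → ∃ C : ℝ, ∀ B : ℕ, 1 ≤ B →
    |(Shute2021.mainCount B : ℝ) - c * B| ≤ C * (B : ℝ) ^ (734 / 735 + ε : ℝ)

/-! ### The fourth moment is a special case of `N(𝐗, 𝐘)` -/

namespace Shute2021

/-- The sign pattern `(+, +, −, −)` of the substitution `(y₃, y₄) ↦ (−y₃, −y₄)`. [folklore] -/
def flipSign : Fin 4 → ℤ := ![1, 1, -1, -1]

/-- `flipSign 0 = 1`. [folklore] -/
@[simp] theorem flipSign_zero : flipSign 0 = 1 := rfl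

/-- `flipSign 1 = 1`. [folklore] -/
@[simp] theorem flipSign_one : flipSign 1 = 1 := rfl

/-- `flipSign 2 = -1`. [folklore] -/
@[simp] theorem flipSign_two : flipSign 2 = -1 := rfl

/-- `flipSign 3 = -1`. [folklore] -/
@[simp] theorem flipSign_three : flipSign 3 = -1 := rfl

/-- The signs square to `1`. [folklore] -/
@[simp] theorem flipSign_mul_self (i : Fin 4) : flipSign i * flipSign i = 1 := by
  fin_cases i <;> rfl

/-- The signs have absolute value `1`. [folklore] -/
@[simp] theorem abs_flipSign (i : Fin 4) : |flipSign i| = 1 := by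
  fin_cases i <;> rfl

/-- The signs have `natAbs` equal to `1`. [folklore] -/
@[simp] theorem natAbs_flipSign (i : Fin 4) : (flipSign i).natAbs = 1 := by
  fin_cases i <;> rfl

/-- The signs are nonzero. [folklore] -/
@[simp] theorem flipSign_ne_zero (i : Fin 4) : flipSign i ≠ 0 := by
  fin_cases i <;> decide

/-- The substitution `(y₃, y₄) ↦ (−y₃, −y₄)` on `(𝐱, 𝐲)`. [folklore] -/
def flipY (p : (Fin 4 → ℤ) × (Fin 4 → ℤ)) : (Fin 4 → ℤ) × (Fin 4 → ℤ) :=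
  (p.1, fun i => flipSign i * p.2 i)

/-- `flipY` is an involution. [folklore] -/
theorem flipY_flipY (p : (Fin 4 → ℤ) × (Fin 4 → ℤ)) : flipY (flipY p) = p :=
  Prod.ext rfl (funext fun i => by simp only [flipY, ← mul_assoc, flipSign_mul_self, one_mul])

/-- The side conditions (`xᵢ ≠ 0`, `yᵢ ≠ 0` square-free, box bounds) are invariant under `flipY`.
[folklore] -/
theorem flipY_mem_iff {X Y : ℕ} (p : (Fin 4 → ℤ) × (Fin 4 → ℤ)) :
    (flipY p ∈ box (fun _ => X) ×ˢ box (fun _ => Y) ∧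
        ∀ i, (flipY p).1 i ≠ 0 ∧ (flipY p).2 i ≠ 0 ∧ Squarefree ((flipY p).2 i).natAbs) ↔
      (p ∈ box (fun _ => X) ×ˢ box (fun _ => Y) ∧
        ∀ i, p.1 i ≠ 0 ∧ p.2 i ≠ 0 ∧ Squarefree (p.2 i).natAbs) := by
  simp only [Finset.mem_product, mem_box, flipY, abs_mul, abs_flipSign, one_mul, ne_eq,
    mul_eq_zero, flipSign_ne_zero, false_or, Int.natAbs_mul, natAbs_flipSign]

/-- **The fourth moment is `N((X,X,X,X), (Y,Y,Y,Y))`**: `(y₃, y₄) ↦ (−y₃, −y₄)` turns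
`x₁²y₁³ + x₂²y₂³ = x₃²y₃³ + x₄²y₄³` into `Σ xᵢ²yᵢ³ = 0` and preserves all side conditions
(square-freeness and the symmetric boxes). [cite: Shute2021, §3, proof of Prop. 3.2] -/
theorem fourthMoment_eq_quadricCount (X Y : ℕ) :
    fourthMoment X Y = quadricCount (fun _ => X) (fun _ => Y) := by
  unfold fourthMoment quadricCount
  refine Finset.card_bij' (fun p _ => flipY p) (fun p _ => flipY p) ?_ ?_
    (fun p _ => flipY_flipY p) (fun p _ => flipY_flipY p)
  · intro p hp
    rw [Finset.mem_filter] at hp ⊢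
    have hside := (flipY_mem_iff (X := X) (Y := Y) p).2 ⟨hp.1, hp.2.1⟩
    refine ⟨hside.1, hside.2, ?_⟩
    rw [Fin.sum_univ_four]
    simp only [flipY, flipSign_zero, flipSign_one, flipSign_two, flipSign_three]
    linear_combination hp.2.2
  · intro p hp
    rw [Finset.mem_filter] at hp ⊢
    have hside := (flipY_mem_iff (X := X) (Y := Y) p).2 ⟨hp.1, hp.2.1⟩
    refine ⟨hside.1, hside.2, ?_⟩
    have h := hp.2.2
    rw [Fin.sum_univ_four] at h
    simp only [flipY, flipSign_zero, flipSign_one, flipSign_two, flipSign_three]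
    linear_combination h

/-! ### The additive energy of the squareful shape is at most the fourth moment -/

/-- A chosen parameter pair `(x, y)` with `x² y³ = s` for `s ∈ S(X, Y)` (and `(1, 1)` otherwise).
[folklore] -/
def pre (X Y : ℕ) (s : ℕ) : ℕ × ℕ :=
  if h : s ∈ squarefulShape X Y then (Finset.mem_image.1 h).choose else (1, 1)

/-- The chosen parameters of `s ∈ S(X, Y)` lie in the parameter box and represent `s`.
[folklore] -/
theorem pre_spec {X Y s : ℕ} (h : s ∈ squarefulShape X Y) :
    pre X Y s ∈ Finset.Icc 1 X ×ˢ (Finset.Icc 1 Y).filter Squarefree ∧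
      (pre X Y s).1 ^ 2 * (pre X Y s).2 ^ 3 = s := by
  rw [pre, dif_pos h]
  exact (Finset.mem_image.1 h).choose_spec

/-- The map from energy quadruples `((a₁, a₂), (b₁, b₂))`, `a₁ + b₁ = a₂ + b₂`, to fourth-moment
solutions: `𝐱 = (x(a₁), x(b₁), x(a₂), x(b₂))`, `𝐲` likewise. [folklore] -/
def toMoment (X Y : ℕ) (q : (ℕ × ℕ) × ℕ × ℕ) : (Fin 4 → ℤ) × (Fin 4 → ℤ) :=
  (fun i => ((![pre X Y q.1.1, pre X Y q.2.1, pre X Y q.1.2, pre X Y q.2.2] i).1 : ℤ),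
   fun i => ((![pre X Y q.1.1, pre X Y q.2.1, pre X Y q.1.2, pre X Y q.2.2] i).2 : ℤ))

/-- One coordinate of `toMoment` satisfies the fourth-moment side conditions. [folklore] -/
theorem pre_side {X Y s : ℕ} (h : s ∈ squarefulShape X Y) :
    (((pre X Y s).1 : ℤ) ≠ 0 ∧ ((pre X Y s).2 : ℤ) ≠ 0 ∧
      Squarefree (((pre X Y s).2 : ℤ)).natAbs) ∧
      |((pre X Y s).1 : ℤ)| ≤ X ∧ |((pre X Y s).2 : ℤ)| ≤ Y := by
  obtain ⟨hmem, -⟩ := pre_spec h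
  simp only [Finset.mem_product, Finset.mem_Icc, Finset.mem_filter] at hmem
  obtain ⟨⟨hx1, hxX⟩, ⟨hy1, hyY⟩, hsq⟩ := hmem
  refine ⟨⟨by exact_mod_cast (by omega : (pre X Y s).1 ≠ 0),
    by exact_mod_cast (by omega : (pre X Y s).2 ≠ 0), by simpa using hsq⟩, ?_, ?_⟩
  · rw [Nat.abs_cast]; exact_mod_cast hxX
  · rw [Nat.abs_cast]; exact_mod_cast hyY

/-- **`E[S(X,Y)] ≤ N(X, Y)`**: choosing parameters `(x, y)` for each element of the image set
`S(X, Y)` injects the energy quadruples into the fourth-moment solutions (positive `xᵢ, yᵢ`).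
[folklore] -/
theorem addEnergy_squarefulShape_le_fourthMoment (X Y : ℕ) :
    Finset.addEnergy (squarefulShape X Y) (squarefulShape X Y) ≤ fourthMoment X Y := by
  classical
  unfold Finset.addEnergy fourthMoment
  refine Finset.card_le_card_of_injOn (toMoment X Y) ?_ ?_
  · intro q hq
    rw [Finset.mem_coe, Finset.mem_filter, Finset.mem_product, Finset.mem_product,
      Finset.mem_product] at hq
    obtain ⟨⟨⟨ha₁, ha₂⟩, hb₁, hb₂⟩, hsum⟩ := hq
    rw [Finset.mem_coe, Finset.mem_filter, Finset.mem_product, mem_box, mem_box]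
    refine ⟨⟨?_, ?_⟩, ?_, ?_⟩
    · intro i
      fin_cases i
      exacts [(pre_side ha₁).2.1, (pre_side hb₁).2.1, (pre_side ha₂).2.1, (pre_side hb₂).2.1]
    · intro i
      fin_cases i
      exacts [(pre_side ha₁).2.2, (pre_side hb₁).2.2, (pre_side ha₂).2.2, (pre_side hb₂).2.2]
    · intro i
      fin_cases i
      exacts [(pre_side ha₁).1, (pre_side hb₁).1, (pre_side ha₂).1, (pre_side hb₂).1]
    · have e₁ := (pre_spec ha₁).2
      have e₂ := (pre_spec ha₂).2
      have e₃ := (pre_spec hb₁).2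
      have e₄ := (pre_spec hb₂).2
      simp only [toMoment, Matrix.cons_val_zero, Matrix.cons_val_one, Matrix.cons_val]
      have : ((q.1.1 + q.2.1 : ℕ) : ℤ) = ((q.1.2 + q.2.2 : ℕ) : ℤ) := by rw [hsum]
      rw [← e₁, ← e₂, ← e₃, ← e₄] at this
      push_cast at this
      linear_combination this
  · intro q hq q' hq' hqq'
    rw [Finset.mem_coe, Finset.mem_filter, Finset.mem_product, Finset.mem_product,
      Finset.mem_product] at hq hq'
    obtain ⟨⟨⟨ha₁, ha₂⟩, hb₁, hb₂⟩, -⟩ := hq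
    obtain ⟨⟨⟨ha₁', ha₂'⟩, hb₁', hb₂'⟩, -⟩ := hq'
    have hx : ∀ i, (toMoment X Y q).1 i = (toMoment X Y q').1 i := fun i => by rw [hqq']
    have hy : ∀ i, (toMoment X Y q).2 i = (toMoment X Y q').2 i := fun i => by rw [hqq']
    have h11 := hx 0; have h21 := hx 1; have h12 := hx 2; have h22 := hx 3
    have k11 := hy 0; have k21 := hy 1; have k12 := hy 2; have k22 := hy 3
    simp only [toMoment, Matrix.cons_val_zero, Matrix.cons_val_one, Matrix.cons_val,
      Nat.cast_inj] at h11 h21 h12 h22 k11 k21 k12 k22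
    have key : ∀ {s s' : ℕ}, s ∈ squarefulShape X Y → s' ∈ squarefulShape X Y →
        (pre X Y s).1 = (pre X Y s').1 → (pre X Y s).2 = (pre X Y s').2 → s = s' := by
      intro s s' hs hs' h1 h2
      rw [← (pre_spec hs).2, ← (pre_spec hs').2, h1, h2]
    exact Prod.ext (Prod.ext (key ha₁ ha₁' h11 k11) (key ha₂ ha₂' h12 k12))
      (Prod.ext (key hb₁ hb₁' h21 k21) (key hb₂ hb₂' h22 k22))

end Shute2021

/-! ### Consequences of Proposition 3.2 consumed by the route -/

/-- Exponent bookkeeping: `(X⁴)^{a + ε/4} = X^{4a} · X^{ε}`-type identity in the form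
`(X ^ 4) ^ e = X ^ (4 * e)` for `X ≥ 0`. [folklore] -/
theorem rpow_pow_four {X : ℝ} (hX : 0 ≤ X) (e : ℝ) : (X ^ 4) ^ e = X ^ (4 * e) := by
  rw [Real.rpow_mul hX, show ((4 : ℝ)) = ((4 : ℕ) : ℝ) by norm_num, Real.rpow_natCast]

/-- **Fourth-moment bound** (the displayed estimate `N(X, Y) = O(X^{2+ε} Y^{8/3+ε})` in the proof
of Prop. 3.2), derived from Prop. 3.2 via `fourthMoment_eq_quadricCount`.
[cite: Shute2021, §3, proof of Prop. 3.2] -/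
theorem Shute2021_prop32.fourthMoment_le (h : Shute2021_prop32) :
    ∀ ε : ℝ, 0 < ε → ∃ C : ℝ, 0 < C ∧ ∀ X Y : ℕ, 1 ≤ X → 1 ≤ Y →
      (Shute2021.fourthMoment X Y : ℝ) ≤ C * (X : ℝ) ^ (2 + ε) * (Y : ℝ) ^ (8 / 3 + ε) := by
  intro ε hε
  obtain ⟨C, hC, hN⟩ := h (ε / 4) (by positivity)
  refine ⟨C, hC, fun X Y hX hY => ?_⟩
  have hb := hN (fun _ => X) (fun _ => Y) (fun _ => hX) (fun _ => hY)
  rw [Shute2021.fourthMoment_eq_quadricCount]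
  simp only [Finset.prod_const, Finset.card_univ, Fintype.card_fin] at hb
  rw [rpow_pow_four (Nat.cast_nonneg X), rpow_pow_four (Nat.cast_nonneg Y)] at hb
  convert hb using 3 <;> ring

/-- **Additive energy of the squareful shape** (what route `ABC/ExceptionalSetEnergy` consumes):
for `S = S(X, Y) = {x²y³ : 1 ≤ x ≤ X, 1 ≤ y ≤ Y, y square-free}` (spelled as in item
`SquarefulShapeEnergy`), `E[S, S] ≤ C (XY)^ε X² Y^{8/3}`. From Prop. 3.2 via
`E[S, S] ≤ N(X, Y)` (`Shute2021.addEnergy_squarefulShape_le_fourthMoment`).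
[cite: Shute2021, Prop. 3.2 and its proof] -/
theorem Shute2021_prop32.addEnergy_squarefulShape_le (h : Shute2021_prop32) :
    ∀ ε : ℝ, 0 < ε → ∃ C : ℝ, 0 < C ∧ ∀ X Y : ℕ, 1 ≤ X → 1 ≤ Y →
      (Finset.addEnergy (Shute2021.squarefulShape X Y) (Shute2021.squarefulShape X Y) : ℝ) ≤
        C * ((X : ℝ) * Y) ^ ε * (X : ℝ) ^ 2 * (Y : ℝ) ^ (8 / 3 : ℝ) := by
  intro ε hε
  obtain ⟨C, hC, hN⟩ := h.fourthMoment_le ε hε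
  refine ⟨C, hC, fun X Y hX hY => ?_⟩
  have hX0 : (0 : ℝ) < X := by exact_mod_cast hX
  have hY0 : (0 : ℝ) < Y := by exact_mod_cast hY
  calc (Finset.addEnergy (Shute2021.squarefulShape X Y) (Shute2021.squarefulShape X Y) : ℝ)
      ≤ Shute2021.fourthMoment X Y := by
        exact_mod_cast Shute2021.addEnergy_squarefulShape_le_fourthMoment X Y
    _ ≤ C * (X : ℝ) ^ (2 + ε) * (Y : ℝ) ^ (8 / 3 + ε) := hN X Y hX hY
    _ = C * ((X : ℝ) * Y) ^ ε * (X : ℝ) ^ 2 * (Y : ℝ) ^ (8 / 3 : ℝ) := by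
        rw [Real.rpow_add hX0, Real.rpow_add hY0, Real.mul_rpow hX0.le hY0.le,
          show ((2 : ℝ)) = ((2 : ℕ) : ℝ) by norm_num, Real.rpow_natCast]
        ring

/-- Monotone form for sub-shapes (e.g. the dyadic pieces `y ~ R` of the route, with `Y = 2R`):
for every `T ⊆ S(X, Y)`, `E[T, T] ≤ C (XY)^ε X² Y^{8/3}` with the constant of
`Shute2021_prop32.addEnergy_squarefulShape_le`. [folklore] -/
theorem Shute2021_prop32.addEnergy_le_of_subset (h : Shute2021_prop32) :
    ∀ ε : ℝ, 0 < ε → ∃ C : ℝ, 0 < C ∧ ∀ X Y : ℕ, 1 ≤ X → 1 ≤ Y → ∀ T : Finset ℕ,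
      T ⊆ Shute2021.squarefulShape X Y →
        (Finset.addEnergy T T : ℝ) ≤ C * ((X : ℝ) * Y) ^ ε * (X : ℝ) ^ 2 * (Y : ℝ) ^ (8 / 3 : ℝ) := by
  intro ε hε
  obtain ⟨C, hC, hE⟩ := h.addEnergy_squarefulShape_le ε hε
  refine ⟨C, hC, fun X Y hX hY T hT => le_trans ?_ (hE X Y hX hY)⟩
  exact_mod_cast Finset.addEnergy_mono hT hT

/-! ### The decomposition `z = y³ x²` of a nonzero squareful integer -/

/-- `y³ x²` is squareful for all nonzero `x, y`. [cite: Shute2021, §1] -/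
theorem isSquareful_pow_three_mul_sq {x y : ℤ} (hx : x ≠ 0) (hy : y ≠ 0) :
    IsSquareful (y ^ 3 * x ^ 2) := by
  refine ⟨mul_ne_zero (pow_ne_zero 3 hy) (pow_ne_zero 2 hx), fun p hp hdvd => ?_⟩
  -- transport to `ℕ` through `natAbs`
  have e : (y ^ 3 * x ^ 2).natAbs = y.natAbs ^ 3 * x.natAbs ^ 2 := by
    rw [Int.natAbs_mul, Int.natAbs_pow, Int.natAbs_pow]
  have hdvd' : p ∣ y.natAbs ^ 3 * x.natAbs ^ 2 := e ▸ Int.natCast_dvd.1 hdvd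
  suffices h2 : p ^ 2 ∣ y.natAbs ^ 3 * x.natAbs ^ 2 by
    have : ((p ^ 2 : ℕ) : ℤ) ∣ y ^ 3 * x ^ 2 := Int.natCast_dvd.2 (e ▸ h2)
    exact_mod_cast this
  rcases (Nat.Prime.dvd_mul hp).1 hdvd' with h | h
  · have hy' : p ∣ y.natAbs := hp.dvd_of_dvd_pow h
    calc p ^ 2 ∣ y.natAbs ^ 2 := pow_dvd_pow_of_dvd hy' 2
      _ ∣ y.natAbs ^ 3 * x.natAbs ^ 2 := Dvd.intro (y.natAbs * x.natAbs ^ 2) (by ring)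
  · have hx' : p ∣ x.natAbs := hp.dvd_of_dvd_pow h
    calc p ^ 2 ∣ x.natAbs ^ 2 := pow_dvd_pow_of_dvd hx' 2
      _ ∣ y.natAbs ^ 3 * x.natAbs ^ 2 := Dvd.intro_left (y.natAbs ^ 3) rfl

/-- A positive integer all of whose prime factors occur squared is `a³ c²` with `a` square-free:
write `n = b² a` with `a` square-free (`Nat.sq_mul_squarefree_of_pos`); every prime `p ∣ a` has
`p² ∣ n = b² a` and `p² ∤ a`, whence `p ∣ b`; so `a ∣ b`, `b = a c` and `n = a³ c²`.
[cite: Shute2021, §1 ("every nonzero squareful integer can be written uniquely as y³x²")] -/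
theorem exists_eq_pow_three_mul_sq_of_primeFactors {n : ℕ} (hn : n ≠ 0)
    (h : ∀ p ∈ n.primeFactors, p ^ 2 ∣ n) :
    ∃ a c : ℕ, 0 < a ∧ 0 < c ∧ Squarefree a ∧ n = a ^ 3 * c ^ 2 := by
  obtain ⟨a, b, ha, hb, hab, hsq⟩ := Nat.sq_mul_squarefree_of_pos (Nat.pos_of_ne_zero hn)
  have hadvd : a ∣ b := by
    rw [← Nat.prod_primeFactors_of_squarefree hsq, Nat.prod_primeFactors_dvd_iff hb.ne']
    intro p hp
    have hpp : p.Prime := Nat.prime_of_mem_primeFactors hp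
    have hpa : p ∣ a := Nat.dvd_of_mem_primeFactors hp
    have hpn : p ^ 2 ∣ n :=
      h p (Nat.mem_primeFactors.2 ⟨hpp, hpa.trans ⟨b ^ 2, by rw [← hab]; ring⟩, hn⟩)
    refine Nat.mem_primeFactors.2 ⟨hpp, ?_, hb.ne'⟩
    by_contra hpb
    have hcop : Nat.Coprime (p ^ 2) (b ^ 2) :=
      Nat.Coprime.pow 2 2 ((Nat.Prime.coprime_iff_not_dvd hpp).2 hpb)
    have hpa2 : p ^ 2 ∣ a := by
      rw [← hab] at hpn
      exact hcop.dvd_of_dvd_mul_left hpn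
    have hunit : IsUnit p := hsq p (by rwa [← pow_two])
    exact hpp.ne_one (Nat.isUnit_iff.1 hunit)
  obtain ⟨c, rfl⟩ := hadvd
  have hc : 0 < c := Nat.pos_of_ne_zero fun hc => by simp [hc] at hb
  exact ⟨a, c, ha, hc, hsq, by rw [← hab]; ring⟩

/-- Uniqueness of `n = a³ c²` with `a` square-free and `c > 0` (compare the parities of the
`p`-adic valuations `3 v_p(a) + 2 v_p(c)` with `v_p(a) ≤ 1`). [cite: Shute2021, §1] -/
theorem pow_three_mul_sq_injective {a a' c c' : ℕ} (ha : Squarefree a) (ha' : Squarefree a')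
    (hc : c ≠ 0) (hc' : c' ≠ 0) (h : a ^ 3 * c ^ 2 = a' ^ 3 * c' ^ 2) : a = a' ∧ c = c' := by
  have ha0 : a ≠ 0 := ha.ne_zero
  have ha0' : a' ≠ 0 := ha'.ne_zero
  have hf : ∀ p, 3 * a.factorization p + 2 * c.factorization p =
      3 * a'.factorization p + 2 * c'.factorization p := by
    intro p
    have e := congrArg (fun m => m.factorization p) h
    simp only [Nat.factorization_mul (pow_ne_zero 3 ha0) (pow_ne_zero 2 hc),
      Nat.factorization_mul (pow_ne_zero 3 ha0') (pow_ne_zero 2 hc'), Nat.factorization_pow,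
      Finsupp.coe_add, Finsupp.coe_smul, Pi.add_apply, Pi.smul_apply, smul_eq_mul] at e
    exact e
  have hfa : ∀ p, a.factorization p = a'.factorization p := fun p => by
    have h1 := ha.natFactorization_le_one p
    have h2 := ha'.natFactorization_le_one p
    have h3 := hf p
    omega
  have haa : a = a' := Nat.eq_of_factorization_eq ha0 ha0' hfa
  refine ⟨haa, Nat.eq_of_factorization_eq hc hc' fun p => ?_⟩
  have h3 := hf p
  rw [hfa p] at h3
  omega

/-- **Existence of the decomposition**: every nonzero squareful integer `z` is `y³ x²` with
`x ≥ 1` and `y ≠ 0` square-free. [cite: Shute2021, §1] -/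
theorem IsSquareful.exists_eq_pow_three_mul_sq {z : ℤ} (hz : IsSquareful z) :
    ∃ q : ℤ × ℤ, 0 < q.1 ∧ q.2 ≠ 0 ∧ Squarefree q.2.natAbs ∧ z = q.2 ^ 3 * q.1 ^ 2 := by
  obtain ⟨hz0, hpr⟩ := isSquareful_iff_primeFactors.1 hz
  obtain ⟨a, c, ha, hc, hsq, hn⟩ :=
    exists_eq_pow_three_mul_sq_of_primeFactors (Int.natAbs_ne_zero.2 hz0) hpr
  have hc' : (0 : ℤ) < c := by exact_mod_cast hc
  have ha' : (a : ℤ) ≠ 0 := by exact_mod_cast ha.ne'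
  rcases Int.natAbs_eq z with hz' | hz'
  · refine ⟨((c : ℤ), (a : ℤ)), hc', ha', ?_, ?_⟩
    · simpa using hsq
    · show z = (a : ℤ) ^ 3 * (c : ℤ) ^ 2
      rw [hz', hn]; push_cast; ring
  · refine ⟨((c : ℤ), -(a : ℤ)), hc', neg_ne_zero.2 ha', ?_, ?_⟩
    · simpa using hsq
    · show z = (-(a : ℤ)) ^ 3 * (c : ℤ) ^ 2
      rw [hz', hn]; push_cast; ring

/-- **Uniqueness of the decomposition** `z = y³ x²` (`x, x' ≥ 1`, `y, y'` square-free).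
[cite: Shute2021, §1] -/
theorem pow_three_mul_sq_eq_iff {x x' y y' : ℤ} (hx : 0 < x) (hx' : 0 < x')
    (hy : Squarefree y.natAbs) (hy' : Squarefree y'.natAbs) :
    y ^ 3 * x ^ 2 = y' ^ 3 * x' ^ 2 ↔ x = x' ∧ y = y' := by
  refine ⟨fun h => ?_, fun h => by rw [h.1, h.2]⟩
  have hnat : y.natAbs ^ 3 * x.natAbs ^ 2 = y'.natAbs ^ 3 * x'.natAbs ^ 2 := by
    have := congrArg Int.natAbs h
    simpa [Int.natAbs_mul, Int.natAbs_pow] using this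
  obtain ⟨-, hxx⟩ := pow_three_mul_sq_injective hy hy' (Int.natAbs_ne_zero.2 hx.ne')
    (Int.natAbs_ne_zero.2 hx'.ne') hnat
  have hxeq : x = x' := by
    have h1 : x = (x.natAbs : ℤ) := (Int.natAbs_of_nonneg hx.le).symm
    have h2 : x' = (x'.natAbs : ℤ) := (Int.natAbs_of_nonneg hx'.le).symm
    rw [h1, h2, hxx]
  subst hxeq
  have h3 : y ^ 3 = y' ^ 3 := mul_right_cancel₀ (pow_ne_zero 2 hx.ne') h
  exact ⟨rfl, (Odd.strictMono_pow (by decide : Odd 3)).injective h3⟩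

open Classical in
/-- The parameters `(x, y)` of a squareful integer `z = y³ x²` (`x ≥ 1`, `y` square-free); junk
`(0, 0)` when `z` is not squareful. [cite: Shute2021, §1 and §3 ("we let xᵢ, yᵢ denote the unique
integers such that xᵢ ∈ ℕ, yᵢ is square-free, and zᵢ = yᵢ³xᵢ²")] -/
def squarefulParams (z : ℤ) : ℤ × ℤ :=
  if h : IsSquareful z then Classical.choose h.exists_eq_pow_three_mul_sq else (0, 0)

/-- The defining property of `squarefulParams z` for squareful `z`. [cite: Shute2021, §1] -/
theorem squarefulParams_spec {z : ℤ} (hz : IsSquareful z) :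
    0 < (squarefulParams z).1 ∧ (squarefulParams z).2 ≠ 0 ∧
      Squarefree (squarefulParams z).2.natAbs ∧
      z = (squarefulParams z).2 ^ 3 * (squarefulParams z).1 ^ 2 := by
  rw [squarefulParams, dif_pos hz]
  exact Classical.choose_spec hz.exists_eq_pow_three_mul_sq

/-- `squarefulParams (y³ x²) = (x, y)` for `x ≥ 1` and `y ≠ 0` square-free (uniqueness).
[cite: Shute2021, §1] -/
theorem squarefulParams_pow_three_mul_sq {x y : ℤ} (hx : 0 < x) (hy : y ≠ 0)
    (hsq : Squarefree y.natAbs) : squarefulParams (y ^ 3 * x ^ 2) = (x, y) := by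
  have hz := isSquareful_pow_three_mul_sq hx.ne' hy
  obtain ⟨h1, -, h3, h4⟩ := squarefulParams_spec hz
  obtain ⟨e1, e2⟩ := (pow_three_mul_sq_eq_iff h1 hx h3 hsq).1 h4.symm
  exact Prod.ext e1 e2

/-- Size of the parameters: `x ≤ |z|` and `|y| ≤ |z|` for `z = y³x²` squareful.
[cite: Shute2021, §3 ("|xᵢ|, |yᵢ| ≤ |zᵢ|")] -/
theorem squarefulParams_abs_le {z : ℤ} (hz : IsSquareful z) :
    |(squarefulParams z).1| ≤ |z| ∧ |(squarefulParams z).2| ≤ |z| := by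
  obtain ⟨h1, h2, -, h4⟩ := squarefulParams_spec hz
  set x := (squarefulParams z).1
  set y := (squarefulParams z).2
  have hy1 : 1 ≤ |y| := Int.one_le_abs h2
  have hx1 : 1 ≤ x := h1
  have habs : |z| = |y| ^ 3 * x ^ 2 := by
    rw [h4, abs_mul, abs_pow, abs_pow, abs_of_pos h1]
  constructor
  · rw [abs_of_pos h1, habs]
    calc x ≤ x ^ 2 := by nlinarith
      _ ≤ |y| ^ 3 * x ^ 2 := le_mul_of_one_le_left (by positivity) (one_le_pow₀ hy1)
  · rw [habs]
    calc |y| ≤ |y| ^ 3 := le_self_pow₀ hy1 (by norm_num)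
      _ ≤ |y| ^ 3 * x ^ 2 := le_mul_of_one_le_right (by positivity) (one_le_pow₀ hx1)

namespace Shute2021

/-! ### Equation (5.1): `N(B) = N(D, B) + O(M(B, D))` -/

open Classical in
/-- Shute's `N(D, B)` (§5, (5.1)): the count `N(B)` (`mainCount`) with the additional constraint
`|y₁y₂y₃y₄| ≤ D` on the square-free parts `yᵢ` of `zᵢ = yᵢ³xᵢ²`.
[cite: Shute2021, §5, (5.1) (definition of N(D,B))] -/
def mainCountTrunc (B D : ℕ) : ℕ :=
  #{z ∈ box (fun _ => B) |
      ((∀ i, IsSquareful (z i)) ∧ IsPrimitive z ∧ ∑ i, z i = 0 ∧ ¬ IsSquare (∏ i, z i)) ∧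
      |∏ i, (squarefulParams (z i)).2| ≤ (D : ℤ)}

/-- `N(D, B) ≤ N(B)`. [folklore] -/
theorem mainCountTrunc_le (B D : ℕ) : mainCountTrunc B D ≤ mainCount B := by
  classical
  unfold mainCountTrunc mainCount
  exact Finset.card_le_card (Finset.monotone_filter_right _ fun z _ h => h.1)

/-- **Equation (5.1), combinatorial form**: `N(B) ≤ N(D, B) + M(B, D + 1)` — a solution counted
by `N(B)` but not by `N(D, B)` has `|y₁y₂y₃y₄| ≥ D + 1`, and `𝐳 ↦ (𝐱, 𝐲)` (`zᵢ = yᵢ³xᵢ²`) injects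
these into the set counted by `M(B, D + 1)` (`|xᵢ|, |yᵢ| ≤ |zᵢ| ≤ B`; the thin-set condition is
simply dropped). [cite: Shute2021, §5, (5.1)] -/
theorem mainCount_le_mainCountTrunc_add (B D : ℕ) :
    mainCount B ≤ mainCountTrunc B D + largeCoeffCount B (D + 1) := by
  classical
  -- the set counted by `N(B)`
  set S : Finset (Fin 4 → ℤ) := {z ∈ box (fun _ => B) |
      (∀ i, IsSquareful (z i)) ∧ IsPrimitive z ∧ ∑ i, z i = 0 ∧ ¬ IsSquare (∏ i, z i)} with hS
  have hmain : mainCount B = #S := by rw [hS]; unfold mainCount; rfl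
  set P : (Fin 4 → ℤ) → Prop := fun z => |∏ i, (squarefulParams (z i)).2| ≤ (D : ℤ) with hP
  have htrunc : mainCountTrunc B D = #(S.filter P) := by
    rw [hS, Finset.filter_filter]; unfold mainCountTrunc; rfl
  have hsplit : #S = #(S.filter P) + #(S.filter fun z => ¬ P z) :=
    (Finset.card_filter_add_card_filter_not P).symm
  rw [hmain, hsplit, ← htrunc]
  refine Nat.add_le_add_left ?_ _
  -- inject the large-`Y` part into the set counted by `M(B, D + 1)`
  unfold largeCoeffCount
  refine Finset.card_le_card_of_injOn
    (fun z => (fun i => (squarefulParams (z i)).1, fun i => (squarefulParams (z i)).2)) ?_ ?_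
  · intro z hz
    rw [Finset.mem_coe, Finset.mem_filter, hS, Finset.mem_filter, mem_box] at hz
    obtain ⟨⟨hbox, hsqf, hprim, hsum, -⟩, hnot⟩ := hz
    have hspec := fun i => squarefulParams_spec (hsqf i)
    have hzi : ∀ i, (squarefulParams (z i)).2 ^ 3 * (squarefulParams (z i)).1 ^ 2 = z i :=
      fun i => (hspec i).2.2.2.symm
    rw [Finset.mem_coe, Finset.mem_filter, Finset.mem_product, mem_box, mem_box]
    refine ⟨⟨fun i => ?_, fun i => ?_⟩, fun i => ⟨(hspec i).1, (hspec i).2.1, (hspec i).2.2.1, ?_⟩,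
      ?_, ?_, ?_⟩
    · exact ((squarefulParams_abs_le (hsqf i)).1.trans (hbox i))
    · exact ((squarefulParams_abs_le (hsqf i)).2.trans (hbox i))
    · rw [hzi]; exact hbox i
    · simp_rw [hzi]; exact hprim
    · simp_rw [hzi]; exact hsum
    · have hlt : (D : ℤ) < |∏ i, (squarefulParams (z i)).2| := not_le.1 hnot
      push_cast
      exact Int.lt_iff_add_one_le.1 hlt
  · intro z hz z' hz' hzz'
    rw [Finset.mem_coe, Finset.mem_filter, hS, Finset.mem_filter] at hz hz'
    have h1 : ∀ i, (squarefulParams (z i)).1 = (squarefulParams (z' i)).1 :=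
      fun i => congrFun (congrArg Prod.fst hzz') i
    have h2 : ∀ i, (squarefulParams (z i)).2 = (squarefulParams (z' i)).2 :=
      fun i => congrFun (congrArg Prod.snd hzz') i
    funext i
    rw [(squarefulParams_spec (hz.1.2.1 i)).2.2.2, (squarefulParams_spec (hz'.1.2.1 i)).2.2.2,
      h1 i, h2 i]

end Shute2021

/-- **Equation (5.1) of Shute (2021)** from Prop. 3.1: for every `ε > 0` there is `C` with
`N(B) ≤ N(D, B) + C B^{1+ε} D^{-1/12}` for all `B, D ≥ 1` ("`N(B) = N(D, B) + O(B^{1+ε}D^{-1/12})`";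
the reverse inequality `N(D, B) ≤ N(B)` is `Shute2021.mainCountTrunc_le`).
[cite: Shute2021, §5, (5.1)] -/
theorem Shute2021_prop31.mainCount_le (h : Shute2021_prop31) :
    ∀ ε : ℝ, 0 < ε → ∃ C : ℝ, 0 < C ∧ ∀ B D : ℕ, 1 ≤ B → 1 ≤ D →
      (Shute2021.mainCount B : ℝ) ≤
        Shute2021.mainCountTrunc B D + C * (B : ℝ) ^ (1 + ε) * (D : ℝ) ^ (-(1 / 12 : ℝ)) := by
  intro ε hε
  obtain ⟨C, hC, hM⟩ := h ε hε
  refine ⟨C, hC, fun B D hB hD => ?_⟩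
  have h1 : (Shute2021.mainCount B : ℝ) ≤
      Shute2021.mainCountTrunc B D + Shute2021.largeCoeffCount B (D + 1) := by
    exact_mod_cast Shute2021.mainCount_le_mainCountTrunc_add B D
  have h2 := hM B (D + 1) hB (Nat.le_add_left 1 D)
  have h3 : ((D + 1 : ℕ) : ℝ) ^ (-(1 / 12 : ℝ)) ≤ (D : ℝ) ^ (-(1 / 12 : ℝ)) :=
    Real.rpow_le_rpow_of_nonpos (by exact_mod_cast hD) (by push_cast; linarith) (by norm_num)
  have hB0 : (0 : ℝ) ≤ C * (B : ℝ) ^ (1 + ε) := by positivity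
  calc (Shute2021.mainCount B : ℝ)
      ≤ Shute2021.mainCountTrunc B D + Shute2021.largeCoeffCount B (D + 1) := h1
    _ ≤ Shute2021.mainCountTrunc B D +
          C * (B : ℝ) ^ (1 + ε) * ((D + 1 : ℕ) : ℝ) ^ (-(1 / 12 : ℝ)) := add_le_add le_rfl h2
    _ ≤ Shute2021.mainCountTrunc B D + C * (B : ℝ) ^ (1 + ε) * (D : ℝ) ^ (-(1 / 12 : ℝ)) :=
        add_le_add le_rfl (mul_le_mul_of_nonneg_left h3 hB0)

end Literature.NumberTheory.DiophantineGeometry
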